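import Mathlib
import Literature.Computability.AlgebraicComplexity.LaserMethodTypeCount

/-!
# `RectangularThmB` (crux stmt-MatrixMultiplication-10597, route ThinBlockAlpha):
# the null-offset chart over `ℤ/9` — data and kernel-checked finite facts

Negative-side support file for the refutation of `ThinBlockAlpha.RectangularThmB`; `sorry`-free.

The chart (Cohn–Kleinberg–Szegedy–Umans 2005, Def. 36) has four symbols `a, b, c, o` (coded `0, 1, 2, 3`)
over `H₀ = ℤ/9`:
`a = (F, {0}, {1})`, `b = ({0}, ℤ/9 ∖ {0,8}, {0})`, `c = ({0}, {0}, F)`, `o = ({0}, {0}, {1})`, `F = ℤ/9 ∖ {0,1}`.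
Each symbol is a TPP triple, and the chart is TRAPPED: every solvable coordinate pattern `(x, y, z)` (in
the index pattern of the tree's `IsSTPP`) has Farkas value `[x ∈ {a,b}] + [y ∈ {b,c}] + (−1,−2,−1,0)(z) ≥ 0`,
and value `0` only when `(Q₁ x, Q₂ y, Q₃ z)` is the profile of a symbol, for the profile partitions
`Q₁ = {a,b}|{c,o}`, `Q₂ = {a,o}|{b,c}`, `Q₃ = {a,c}|{b}|{o}` (`nullChart_facts`, by `decide`).

* `nullChart_facts` — per-symbol TPP and trapping.
* `farkas_sum_symbol` — the Farkas functional vanishes on the diagonal (so it sums to `0` along any three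
  rows of one composition class).
* `sum_apply_eq_sum_letterCount` — regrouping a coordinate sum by letters.
* `exponent_pi_zmod9_le` — `(ℤ/9)ⁿ` has exponent `≤ 9`.
-/

set_option linter.dupNamespace false

namespace Summit.MatrixMultiplication.MatrixMultiplication.Theorems.RectangularThmB.Negative

open Literature.Computability.AlgebraicComplexity

/-- `F = ℤ/9 ∖ {0, 1}`. -/
def nullF : Finset (ZMod 9) := {2, 3, 4, 5, 6, 7, 8}
/-- `G = ℤ/9 ∖ {0, 8} = -F`. -/
def nullG : Finset (ZMod 9) := {1, 2, 3, 4, 5, 6, 7}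
/-- First legs of the symbols `a, b, c, o` (coded `0, 1, 2, 3`). -/
def nullA : Fin 4 → Finset (ZMod 9) := ![nullF, {0}, {0}, {0}]
/-- Middle legs. -/
def nullB : Fin 4 → Finset (ZMod 9) := ![{0}, nullG, {0}, {0}]
/-- Last legs. -/
def nullC : Fin 4 → Finset (ZMod 9) := ![{1}, {0}, nullF, {1}]
/-- Profile partition `Q₁ = {a,b} | {c,o}`. -/
def prof₁ : Fin 4 → Fin 2 := ![0, 0, 1, 1]
/-- Profile partition `Q₂ = {a,o} | {b,c}`. -/
def prof₂ : Fin 4 → Fin 2 := ![0, 1, 1, 0]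
/-- Profile partition `Q₃ = {a,c} | {b} | {o}` (the `D`-lumping). -/
def prof₃ : Fin 4 → Fin 3 := ![0, 1, 0, 2]
/-- Farkas functional, first slot. -/
def farkas₁ : Fin 4 → ℤ := ![1, 1, 0, 0]
/-- Farkas functional, second slot. -/
def farkas₂ : Fin 4 → ℤ := ![0, 1, 1, 0]
/-- Farkas functional, third slot. -/
def farkas₃ : Fin 4 → ℤ := ![-1, -2, -1, 0]

/-- **Finite chart facts** (kernel-checked by `decide`): per-symbol TPP, and trapping — a solvable
pattern has nonnegative Farkas value, and value zero only on profile-closed patterns (the listed Finset is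
the set of profiles `(Q₁, Q₂, Q₃)` of the four symbols).
[cite: CohnKleinbergSzegedyUmans2005, Def. 36 (p. 11)] -/
theorem nullChart_facts :
    (∀ x : Fin 4, ∀ s ∈ nullA x, ∀ s' ∈ nullA x, ∀ t ∈ nullB x, ∀ t' ∈ nullB x, ∀ u ∈ nullC x,
      ∀ u' ∈ nullC x, (s' - s) + (t' - t) + (u' - u) = 0 → s = s' ∧ t = t' ∧ u = u') ∧
    (∀ x y z : Fin 4, (∃ s ∈ nullA z, ∃ s' ∈ nullA x, ∃ t ∈ nullB x, ∃ t' ∈ nullB y, ∃ u ∈ nullC y,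
      ∃ u' ∈ nullC z, (s' - s) + (t' - t) + (u' - u) = 0) →
      0 ≤ farkas₁ x + farkas₂ y + farkas₃ z ∧
      (farkas₁ x + farkas₂ y + farkas₃ z = 0 →
        (prof₁ x, prof₂ y, prof₃ z) ∈ ({(0, 0, 0), (0, 1, 1), (1, 1, 0), (1, 0, 2)} :
          Finset (Fin 2 × Fin 2 × Fin 3)))) := by
  refine ⟨?_, ?_⟩
  · intro x
    fin_cases x <;> decide
  · intro x y z
    fin_cases x <;> fin_cases y <;> fin_cases z <;> decide

/-- The Farkas functional vanishes on every diagonal pattern `(x, x, x)`. -/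
theorem farkas_sum_symbol (x : Fin 4) : farkas₁ x + farkas₂ x + farkas₃ x = 0 := by
  fin_cases x <;> decide

/-- Regrouping a sum over positions by letters. -/
theorem sum_apply_eq_sum_letterCount {n : ℕ} (f : Fin 4 → ℤ) (u : Fin n → Fin 4) :
    ∑ c, f (u c) = ∑ x, (letterCount u x : ℤ) * f x := by
  have h : ∀ c : Fin n, f (u c) = ∑ x : Fin 4, if u c = x then f x else 0 := by
    intro c
    rw [Finset.sum_ite_eq]
    simp
  simp_rw [h]
  rw [Finset.sum_comm]
  refine Finset.sum_congr rfl fun x _ => ?_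
  rw [letterCount_apply, ← Finset.sum_filter, Finset.sum_const, nsmul_eq_mul]

/-- `(ℤ/9)ⁿ` has exponent at most (in fact dividing) `9`. -/
theorem exponent_pi_zmod9_le (n : ℕ) : AddMonoid.exponent (Fin n → ZMod 9) ≤ 9 := by
  apply Nat.le_of_dvd (by norm_num)
  apply AddMonoid.exponent_dvd_of_forall_nsmul_eq_zero
  intro g
  funext j
  show 9 • g j = 0
  rw [nsmul_eq_mul, ZMod.natCast_self, zero_mul]

end Summit.MatrixMultiplication.MatrixMultiplication.Theorems.RectangularThmB.Negative
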